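import Summits.KontsevichZagierPeriods.KontsevichZagierPeriods.Theorems.LinRedNormalFormArrangementNormalFormStubRebaseSimplePosOnePosHUSplit
import Summits.KontsevichZagierPeriods.KontsevichZagierPeriods.Theorems.LinRedNormalFormArrangementNormalFormStubRebaseSimplePosOnePosQuadLocal

/-!
# Stub `stub_rebaseSimplePosOnePos` (crux `ArrangementNormalForm`, line `janus-bands`) —
part `HURatio`: the engine hypotheses on a localised quadrant chamber (`B = 2`)

Towards the residue `HU` of the one-fibre rebase over the base `(x₁, x₂, y)`, treated by the
re-selection `RebasePos.good_reselect` (part `HUSplit`) along the direction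
`d = (σ₀, −σ₁ q, ν)`, `q > 0`, attached to the quadrant `(σ₀, σ₁)` of the silent plane at the
triple point `X`. This file derives the three engine hypotheses of `good_reselect` for the
letters `jjL L ℓ₂` (the lifted silent factors `Lⱼ` and the pole form `y − ℓ₂`) on a base cell
lying in that quadrant (`hquad`) from:
* the algebraic facts at the point `P₀ = (X, Y)` (part `HUChoice`): every active non-constant
  letter is moved by `d` (`hact`), and the resultant `R = ∂_d Λ · Λ' − ∂_d Λ' · Λ` of every relevant
  ordered pair that is not a pair of NEAR silent factors (`Lⱼ(X) = L_{j'}(X) = 0`) does not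
  vanish at `P₀` (`hres0`);
* the sign constancy of the near silent factors on the cell (`hnear`, after the cuts along them);
* the closeness of the cell to `P₀` (`hclose`, part `HUChoice`): on the cell every letter and
  every resultant deviates from its value at `P₀` by less than half that value when it is
  non-zero, and by at most `1`.
The one estimate which is not a perturbation of `P₀` is the ratio condition for two NEAR silent
factors (`RebasePos.ratio_nearNear`): their resultant is `B σ₁ (q σ₀ Δ₀ + σ₁ Δ₁)` in terms of
`Δ = x − X`, which dominates `|Δ₀| + |Δ₁|` on the quadrant because the direction `(σ₀, −σ₁ q)` is
EXTERIOR to it, while a near factor is `O(|Δ₀| + |Δ₁|)`. Main result: `RebasePos.good_chamber`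
(registered as `rebaseSimplePos_goodChamber`).

References: M. Kontsevich, D. Zagier, *Periods* (2001), §1.2.
-/

noncomputable section

open Set MeasureTheory MvPolynomial
open Literature.NumberTheory.Transcendental Literature.ModelTheory.ExponentialFields

namespace Summit.KontsevichZagierPeriods.ArrangementNormalForm.JanusBands

namespace RebasePos

open SeparatePos

section Ratio

variable {m m' : ℕ}

/-- Evaluation of a full-base affine form at a rational point of the base. -/
def evQ (c : (Fin (2 + 1) → ℚ) × ℚ) (P : Fin (2 + 1) → ℚ) : ℚ := ∑ i, c.1 i * P i + c.2

/-- The resultant form `∂_d c · c' − ∂_d c' · c` of an ordered pair of letters along `d`. -/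
def resF (c c' : (Fin (2 + 1) → ℚ) × ℚ) (d : Fin (2 + 1) → ℚ) : (Fin (2 + 1) → ℚ) × ℚ :=
  dd c d • c' - dd c' d • c

/-- The value of an `x'`-form at a rational point of the silent plane (a NEAR silent factor at `X`
is one with `valX c X = 0`). -/
def valX (c : (Fin 2 → ℚ) × ℚ) (X : Fin 2 → ℚ) : ℚ := c.1 0 * X 0 + c.1 1 * X 1 + c.2

/-- The deviation of a form from its value at a point. -/
theorem affF_sub_evQ (c : (Fin (2 + 1) → ℚ) × ℚ) (P : Fin (2 + 1) → ℚ) (z : Fin (2 + 1 + 1) → ℝ) :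
    affF 2 1 c z - (evQ c P : ℝ) = ∑ i, (c.1 i : ℝ) * (z (Fin.castAdd 1 i) - P i) := by
  simp only [affF, evQ, Rat.cast_add, Rat.cast_sum, Rat.cast_mul, mul_sub, Finset.sum_sub_distrib]
  ring

/-- The resultant form evaluates to the resultant. -/
theorem affF_resF (c c' : (Fin (2 + 1) → ℚ) × ℚ) (d : Fin (2 + 1) → ℚ) (z : Fin (2 + 1 + 1) → ℝ) :
    affF 2 1 (resF c c' d) z = (dd c d : ℝ) * affF 2 1 c' z - (dd c' d : ℝ) * affF 2 1 c z := by
  rw [resF, affF_sub'', affF_smul', affF_smul']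

/-- A near silent factor in terms of `Δ = x − X`. -/
theorem affF_liftX_near (c : (Fin 2 → ℚ) × ℚ) (X : Fin 2 → ℚ) (h : valX c X = 0) (z : Fin (2 + 1 + 1) → ℝ) :
    affF 2 1 (liftX c) z = (c.1 0 : ℝ) * (z 0 - X 0) + (c.1 1 : ℝ) * (z 1 - X 1) := by
  rw [affF_liftX, affB_three]
  have h' : ((c.1 0 * X 0 + c.1 1 * X 1 + c.2 : ℚ) : ℝ) = 0 := by rw [← valX, h, Rat.cast_zero]
  push_cast at h'
  linear_combination h'

/-- The `x'`-coefficients of a lifted silent factor. -/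
theorem liftX_fst_castSucc (c : (Fin 2 → ℚ) × ℚ) (i : Fin 2) : (liftX c).1 (Fin.castSucc i) = c.1 i := by
  simp [liftX]

/-- The `y`-coefficient of a lifted silent factor. -/
theorem liftX_fst_last (c : (Fin 2 → ℚ) × ℚ) : (liftX c).1 (Fin.last 2) = 0 :=
  liftX_last c

/-- `∂_d` of a lifted silent factor. -/
theorem dd_liftX (c : (Fin 2 → ℚ) × ℚ) (d : Fin (2 + 1) → ℚ) : dd (liftX c) d = c.1 0 * d 0 + c.1 1 * d 1 := by
  rw [dd, Fin.sum_univ_castSucc, liftX_fst_last, zero_mul, add_zero, Fin.sum_univ_two,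
    liftX_fst_castSucc, liftX_fst_castSucc]
  rfl

/-- **The ratio condition for two NEAR silent factors on the quadrant `(σ₀, σ₁)` at `X`, along the
exterior direction `d = (σ₀, −σ₁ q, ν)`.** See the module docstring. -/
theorem ratio_nearNear (σ₀ σ₁ q : ℚ) (hσ₀ : σ₀ * σ₀ = 1) (hσ₁ : σ₁ * σ₁ = 1) (hq : 0 < q)
    (d : Fin (2 + 1) → ℚ) (hd0 : d 0 = σ₀) (hd1 : d 1 = -(σ₁ * q)) (X : Fin 2 → ℚ)
    (c c' : (Fin 2 → ℚ) × ℚ) (hc : valX c X = 0) (hc' : valX c' X = 0)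
    (hne : dd (liftX c') d • liftX c ≠ dd (liftX c) d • liftX c') :
    ∃ C : ℝ, ∀ z : Fin (2 + 1 + 1) → ℝ, 0 < (σ₀ : ℝ) * (z 0 - X 0) → 0 < (σ₁ : ℝ) * (z 1 - X 1) →
      |affF 2 1 (liftX c') z| ≤ C * |(dd (liftX c) d : ℝ) * affF 2 1 (liftX c') z -
        (dd (liftX c') d : ℝ) * affF 2 1 (liftX c) z| := by
  set a : ℚ := c.1 0 with ha
  set b : ℚ := c.1 1 with hb
  set a' : ℚ := c'.1 0 with ha'
  set b' : ℚ := c'.1 1 with hb'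
  set D : ℚ := dd (liftX c) d with hD
  set D' : ℚ := dd (liftX c') d with hD'
  set A : ℚ := D * a' - D' * a with hA
  set B : ℚ := D * b' - D' * b with hB
  have hDv : D = a * σ₀ - b * (σ₁ * q) := by rw [hD, dd_liftX, hd0, hd1]; ring
  have hDv' : D' = a' * σ₀ - b' * (σ₁ * q) := by rw [hD', dd_liftX, hd0, hd1]; ring
  have hAB : A * σ₀ = B * (σ₁ * q) := by rw [hA, hB, hDv, hDv']; ring
  have hAB' : A = B * (σ₁ * q) * σ₀ := by
    have : A = A * σ₀ * σ₀ := by rw [mul_assoc, hσ₀, mul_one]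
    rw [this, hAB]
  -- `B ≠ 0`, otherwise the two weighted letters coincide
  have hB0 : B ≠ 0 := by
    intro hB0
    have hA0 : A = 0 := by rw [hAB', hB0]; ring
    refine hne (Prod.ext (funext fun i => ?_) ?_)
    · simp only [Prod.smul_fst, Pi.smul_apply, smul_eq_mul]
      refine Fin.lastCases ?_ (fun i => ?_) i
      · rw [liftX_fst_last, liftX_fst_last, mul_zero, mul_zero]
      · rw [liftX_fst_castSucc, liftX_fst_castSucc]
        fin_cases i
        · show D' * c.1 0 = D * c'.1 0
          linear_combination -hA0
        · show D' * c.1 1 = D * c'.1 1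
          linear_combination -hB0
    · simp only [Prod.smul_snd, smul_eq_mul]
      have h2 : c.2 = -(a * X 0 + b * X 1) := by rw [valX] at hc; linear_combination hc
      have h2' : c'.2 = -(a' * X 0 + b' * X 1) := by rw [valX] at hc'; linear_combination hc'
      show D' * (liftX c).2 = D * (liftX c').2
      rw [show (liftX c).2 = c.2 from rfl, show (liftX c').2 = c'.2 from rfl, h2, h2']
      linear_combination X 0 * hA0 + X 1 * hB0
  -- the constant
  have hq1 : (0 : ℝ) < min (q : ℝ) 1 := lt_min (by exact_mod_cast hq) one_pos
  have hBpos : (0 : ℝ) < |(B : ℝ)| := abs_pos.2 (by exact_mod_cast hB0)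
  refine ⟨(|(a' : ℝ)| + |(b' : ℝ)|) / (|(B : ℝ)| * min (q : ℝ) 1), fun z h0 h1 => ?_⟩
  set Δ₀ : ℝ := z 0 - X 0 with hΔ₀
  set Δ₁ : ℝ := z 1 - X 1 with hΔ₁
  have hσ₀' : (σ₀ : ℝ) * σ₀ = 1 := by exact_mod_cast hσ₀
  have hσ₁' : (σ₁ : ℝ) * σ₁ = 1 := by exact_mod_cast hσ₁
  have hs₀ : |(σ₀ : ℝ)| = 1 := by
    rcases mul_self_eq_one_iff.1 hσ₀' with h | h <;> simp [h]
  have hs₁ : |(σ₁ : ℝ)| = 1 := by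
    rcases mul_self_eq_one_iff.1 hσ₁' with h | h <;> simp [h]
  have habs₀ : |Δ₀| = (σ₀ : ℝ) * Δ₀ := by
    rw [← abs_of_pos h0, abs_mul, hs₀, one_mul]
  have habs₁ : |Δ₁| = (σ₁ : ℝ) * Δ₁ := by
    rw [← abs_of_pos h1, abs_mul, hs₁, one_mul]
  set T : ℝ := (σ₀ : ℝ) * Δ₀ + (σ₁ : ℝ) * Δ₁ with hT
  have hT0 : 0 < T := add_pos h0 h1
  -- the near factor is `O(T)`
  have hΛ : affF 2 1 (liftX c') z = (a' : ℝ) * Δ₀ + (b' : ℝ) * Δ₁ := affF_liftX_near c' X hc' z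
  have hΛle : |affF 2 1 (liftX c') z| ≤ (|(a' : ℝ)| + |(b' : ℝ)|) * T := by
    rw [hΛ]
    calc |(a' : ℝ) * Δ₀ + (b' : ℝ) * Δ₁| ≤ |(a' : ℝ) * Δ₀| + |(b' : ℝ) * Δ₁| := abs_add_le _ _
      _ = |(a' : ℝ)| * ((σ₀ : ℝ) * Δ₀) + |(b' : ℝ)| * ((σ₁ : ℝ) * Δ₁) := by
          rw [abs_mul, abs_mul, habs₀, habs₁]
      _ ≤ (|(a' : ℝ)| + |(b' : ℝ)|) * T := by
          rw [hT]
          nlinarith [abs_nonneg (a' : ℝ), abs_nonneg (b' : ℝ)]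
  -- the resultant dominates `T`
  have hR : (dd (liftX c) d : ℝ) * affF 2 1 (liftX c') z - (dd (liftX c') d : ℝ) * affF 2 1 (liftX c) z =
      (B : ℝ) * σ₁ * ((q : ℝ) * ((σ₀ : ℝ) * Δ₀) + (σ₁ : ℝ) * Δ₁) := by
    rw [affF_liftX_near c X hc z, affF_liftX_near c' X hc' z, ← hD, ← hD']
    have hABr : (A : ℝ) = (B : ℝ) * ((σ₁ : ℝ) * q) * σ₀ := by exact_mod_cast hAB'
    have hAr : (A : ℝ) = (D : ℝ) * a' - (D' : ℝ) * a := by rw [hA]; push_cast; ring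
    have hBr : (B : ℝ) = (D : ℝ) * b' - (D' : ℝ) * b := by rw [hB]; push_cast; ring
    rw [← hΔ₀, ← hΔ₁]
    linear_combination -Δ₀ * hAr - Δ₁ * hBr + Δ₀ * hABr - (B : ℝ) * Δ₁ * hσ₁'
  have hRge : |(B : ℝ)| * min (q : ℝ) 1 * T ≤
      |(dd (liftX c) d : ℝ) * affF 2 1 (liftX c') z - (dd (liftX c') d : ℝ) * affF 2 1 (liftX c) z| := by
    rw [hR, abs_mul, abs_mul]
    have hin : min (q : ℝ) 1 * T ≤ (q : ℝ) * ((σ₀ : ℝ) * Δ₀) + (σ₁ : ℝ) * Δ₁ := by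
      rw [hT]
      nlinarith [min_le_left (q : ℝ) 1, min_le_right (q : ℝ) 1, h0, h1]
    have hpos : 0 < (q : ℝ) * ((σ₀ : ℝ) * Δ₀) + (σ₁ : ℝ) * Δ₁ := lt_of_lt_of_le (mul_pos hq1 hT0) hin
    rw [hs₁, mul_one, abs_of_pos hpos, mul_assoc]
    exact mul_le_mul_of_nonneg_left hin (abs_nonneg _)
  -- conclusion
  calc |affF 2 1 (liftX c') z| ≤ (|(a' : ℝ)| + |(b' : ℝ)|) * T := hΛle
    _ = (|(a' : ℝ)| + |(b' : ℝ)|) / (|(B : ℝ)| * min (q : ℝ) 1) * (|(B : ℝ)| * min (q : ℝ) 1 * T) := by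
        field_simp
    _ ≤ _ := mul_le_mul_of_nonneg_left hRge (div_nonneg (by positivity) (by positivity))

variable (L : Fin m → (Fin 2 → ℚ) × ℚ) (e : Fin m → ℕ) (ℓ₁ ℓ₂ : (Fin 2 → ℚ) × ℚ)

/-- **The engine hypotheses on a localised quadrant chamber, hence goodness** (`B = 2`). See the
module docstring: the band data of `good_reselect`, the quadrant `(σ₀, σ₁)` at `X` containing the
base cell, the direction `d = (σ₀, −σ₁ q, ν)`, the point `P₀` (`X` lifted by the `y`-value `Y`),
the algebraic facts `hact`, `hres0` at `P₀`, the signs of the near factors `hnear`, and the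
closeness facts `hclose₁` (half the value) and `hclose₂` (deviation at most `1`). -/
theorem good_chamber (s : KZ.IntegralRep (2 + 1 + 1)) (M : Fin m' → (Fin (2 + 1) → ℚ) × ℚ)
    (p : MvPolynomial (Fin 2) ℚ) (u v : (Fin (2 + 1) → ℚ) × ℚ) (hbd : Bornology.IsBounded s.domain)
    (hdom : s.domain = gDom 2 1 m' M (fun _ => Sum.inr u) (fun _ => Sum.inr v))
    (hint : EqOn s.integrand (glit 2 1 p L e ℓ₁ ℓ₂ 0 1 (fun _ => some 0)) s.domain)
    (huv : ∀ z : Fin (2 + 1 + 1) → ℝ, (∀ j, 0 < affF 2 1 (M j) z) → affF 2 1 u z < affF 2 1 v z)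
    (σ₀ σ₁ q : ℚ) (hσ₀ : σ₀ * σ₀ = 1) (hσ₁ : σ₁ * σ₁ = 1) (hq : 0 < q)
    (d : Fin (2 + 1) → ℚ) (hd0 : d 0 = σ₀) (hd1 : d 1 = -(σ₁ * q)) (hd : d (Fin.last 2) ≠ 0)
    (θ : ℚ) (hθ0 : 0 < θ) (hθ1 : θ < 1) (hdu : dd u d ≠ 0) (hlev : dd u d + θ * dd (v - u) d = 0)
    (X : Fin 2 → ℚ) (P₀ : Fin (2 + 1) → ℚ)
    (hquad : ∀ z : Fin (2 + 1 + 1) → ℝ, (∀ j, 0 < affF 2 1 (M j) z) →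
      0 < (σ₀ : ℝ) * (z 0 - X 0) ∧ 0 < (σ₁ : ℝ) * (z 1 - X 1))
    (hact : ∀ j, jjE e j ≠ 0 → (jjL L ℓ₂ j).1 ≠ 0 → dd (jjL L ℓ₂ j) d ≠ 0)
    (hres0 : ∀ j j', jjE e j ≠ 0 → jjE e j' ≠ 0 → dd (jjL L ℓ₂ j) d ≠ 0 → dd (jjL L ℓ₂ j') d ≠ 0 →
      dd (jjL L ℓ₂ j') d • jjL L ℓ₂ j ≠ dd (jjL L ℓ₂ j) d • jjL L ℓ₂ j' →
      ¬ (∃ i i' : Fin m, j = Fin.castSucc i ∧ j' = Fin.castSucc i' ∧ valX (L i) X = 0 ∧ valX (L i') X = 0) →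
      evQ (resF (jjL L ℓ₂ j) (jjL L ℓ₂ j') d) P₀ ≠ 0)
    (hnear : ∀ i : Fin m, e i ≠ 0 → (L i).1 ≠ 0 → valX (L i) X = 0 →
      (∀ z : Fin (2 + 1 + 1) → ℝ, (∀ j, 0 < affF 2 1 (M j) z) → 0 < affB 2 1 (L i) z) ∨
      (∀ z : Fin (2 + 1 + 1) → ℝ, (∀ j, 0 < affF 2 1 (M j) z) → affB 2 1 (L i) z < 0))
    (hfar0 : ∀ j, jjE e j ≠ 0 → dd (jjL L ℓ₂ j) d ≠ 0 →
      ¬ (∃ i : Fin m, j = Fin.castSucc i ∧ valX (L i) X = 0) → evQ (jjL L ℓ₂ j) P₀ ≠ 0)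
    (hclose₁ : ∀ c : (Fin (2 + 1) → ℚ) × ℚ,
      ((∃ j, c = jjL L ℓ₂ j) ∨ (∃ j j', c = resF (jjL L ℓ₂ j) (jjL L ℓ₂ j') d)) → evQ c P₀ ≠ 0 →
      ∀ z : Fin (2 + 1 + 1) → ℝ, (∀ j, 0 < affF 2 1 (M j) z) →
      2 * |affF 2 1 c z - (evQ c P₀ : ℝ)| < |(evQ c P₀ : ℝ)|)
    (hclose₂ : ∀ j, ∀ z : Fin (2 + 1 + 1) → ℝ, (∀ j, 0 < affF 2 1 (M j) z) →
      |affF 2 1 (jjL L ℓ₂ j) z - (evQ (jjL L ℓ₂ j) P₀ : ℝ)| ≤ 1) :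
    ∃ c ∈ AddSubgroup.closure (GGset 2 2 1), KZ.of s - c ∈ KZ.relations := by
  -- lower bound for a form close to its non-zero value at `P₀`
  have lower : ∀ c : (Fin (2 + 1) → ℚ) × ℚ,
      ((∃ j, c = jjL L ℓ₂ j) ∨ (∃ j j', c = resF (jjL L ℓ₂ j) (jjL L ℓ₂ j') d)) → evQ c P₀ ≠ 0 →
      ∀ z : Fin (2 + 1 + 1) → ℝ, (∀ j, 0 < affF 2 1 (M j) z) → |(evQ c P₀ : ℝ)| / 2 ≤ |affF 2 1 c z| := by
    intro c hc h0 z hz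
    have h := hclose₁ c hc h0 z hz
    have htri : |(evQ c P₀ : ℝ)| ≤ |affF 2 1 c z| + |affF 2 1 c z - (evQ c P₀ : ℝ)| := by
      have := abs_sub_abs_le_abs_sub (evQ c P₀ : ℝ) (affF 2 1 c z)
      rw [abs_sub_comm] at this
      linarith
    linarith
  -- upper bound for the letters
  have upper : ∀ j, ∀ z : Fin (2 + 1 + 1) → ℝ, (∀ j, 0 < affF 2 1 (M j) z) →
      |affF 2 1 (jjL L ℓ₂ j) z| ≤ |(evQ (jjL L ℓ₂ j) P₀ : ℝ)| + 1 := fun j z hz => by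
    have h := hclose₂ j z hz
    have := abs_sub_abs_le_abs_sub (affF 2 1 (jjL L ℓ₂ j) z) (evQ (jjL L ℓ₂ j) P₀ : ℝ)
    linarith
  refine good_reselect L e ℓ₁ ℓ₂ s M p u v hbd hdom hint huv d hd θ hθ0 hθ1 hdu hlev hact
    (fun j hα he z hz => ?_) (fun j j' hα hα' he he' hne => ?_)
  · -- active moved letters do not vanish on the cell
    by_cases hnj : ∃ i : Fin m, j = Fin.castSucc i ∧ valX (L i) X = 0
    · obtain ⟨i, rfl, hi⟩ := hnj
      rw [jjE_castSucc] at he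
      rw [jjL_castSucc, affF_liftX]
      have hLi : (L i).1 ≠ 0 := fun h0 => hα (by rw [jjL_castSucc, dd_liftX, h0]; simp)
      rcases hnear i he hLi hi with h | h
      · exact ne_of_gt (h z hz)
      · exact ne_of_lt (h z hz)
    · have h0 := hfar0 j he hα hnj
      have h := lower _ (Or.inl ⟨j, rfl⟩) h0 z hz
      have hpos : 0 < |(evQ (jjL L ℓ₂ j) P₀ : ℝ)| / 2 := by
        have : (evQ (jjL L ℓ₂ j) P₀ : ℝ) ≠ 0 := by exact_mod_cast h0
        positivity
      exact abs_pos.1 (lt_of_lt_of_le hpos h)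
  · -- the ratio condition
    by_cases hnn : ∃ i i' : Fin m, j = Fin.castSucc i ∧ j' = Fin.castSucc i' ∧ valX (L i) X = 0 ∧ valX (L i') X = 0
    · obtain ⟨i, i', rfl, rfl, hi, hi'⟩ := hnn
      simp only [jjL_castSucc] at hne ⊢
      obtain ⟨C, hC⟩ := ratio_nearNear σ₀ σ₁ q hσ₀ hσ₁ hq d hd0 hd1 X (L i) (L i') hi hi' hne
      exact ⟨C, fun z hz => hC z (hquad z hz).1 (hquad z hz).2⟩
    · have h0 := hres0 j j' he he' hα hα' hne hnn
      set R : (Fin (2 + 1) → ℚ) × ℚ := resF (jjL L ℓ₂ j) (jjL L ℓ₂ j') d with hRdef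
      have hR0 : (0 : ℝ) < |(evQ R P₀ : ℝ)| / 2 := by
        have : (evQ R P₀ : ℝ) ≠ 0 := by exact_mod_cast h0
        positivity
      refine ⟨(|(evQ (jjL L ℓ₂ j') P₀ : ℝ)| + 1) / (|(evQ R P₀ : ℝ)| / 2), fun z hz => ?_⟩
      have h1 := upper j' z hz
      have h2 := lower R (Or.inr ⟨j, j', rfl⟩) h0 z hz
      rw [hRdef, affF_resF] at h2
      calc |affF 2 1 (jjL L ℓ₂ j') z| ≤ |(evQ (jjL L ℓ₂ j') P₀ : ℝ)| + 1 := h1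
        _ = (|(evQ (jjL L ℓ₂ j') P₀ : ℝ)| + 1) / (|(evQ R P₀ : ℝ)| / 2) * (|(evQ R P₀ : ℝ)| / 2) := by
            field_simp
        _ ≤ _ := mul_le_mul_of_nonneg_left h2 (div_nonneg (by positivity) hR0.le)

end Ratio

end RebasePos

/-- **Registered part of `stub_rebaseSimplePosOnePos` (line `janus-bands`): a localised quadrant
chamber of a thin parallel cell is good** (`RebasePos.good_chamber`): the engine hypotheses of
the re-selection `RebasePos.good_reselect` along the exterior direction `d = (σ₀, −σ₁ q, ν)` of the
quadrant `(σ₀, σ₁)` at the triple point follow from the algebraic facts at the point `P₀`, the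
signs of the near silent factors on the chamber and the closeness of the chamber to `P₀`; the
near–near ratio condition is the quadrant estimate `RebasePos.ratio_nearNear`. -/
theorem rebaseSimplePos_goodChamber (m m' : ℕ) (L : Fin m → (Fin 2 → ℚ) × ℚ) (e : Fin m → ℕ) (ℓ₁ ℓ₂ : (Fin 2 → ℚ) × ℚ) (s : KZ.IntegralRep (2 + 1 + 1)) (M : Fin m' → (Fin (2 + 1) → ℚ) × ℚ) (p : MvPolynomial (Fin 2) ℚ) (u v : (Fin (2 + 1) → ℚ) × ℚ) (hbd : Bornology.IsBounded s.domain) (hdom : s.domain = SeparatePos.gDom 2 1 m' M (fun _ => Sum.inr u) (fun _ => Sum.inr v)) (hint : Set.EqOn s.integrand (RebasePos.glit 2 1 p L e ℓ₁ ℓ₂ 0 1 (fun _ => some 0)) s.domain) (huv : ∀ z : Fin (2 + 1 + 1) → ℝ, (∀ j, 0 < SeparatePos.affF 2 1 (M j) z) → SeparatePos.affF 2 1 u z < SeparatePos.affF 2 1 v z) (σ₀ σ₁ q : ℚ) (hσ₀ : σ₀ * σ₀ = 1) (hσ₁ : σ₁ * σ₁ = 1) (hq : 0 < q) (d : Fin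 (2 + 1) → ℚ) (hd0 : d 0 = σ₀) (hd1 : d 1 = -(σ₁ * q)) (hd : d (Fin.last 2) ≠ 0) (θ : ℚ) (hθ0 : 0 < θ) (hθ1 : θ < 1) (hdu : RebasePos.dd u d ≠ 0) (hlev : RebasePos.dd u d + θ * RebasePos.dd (v - u) d = 0) (X : Fin 2 → ℚ) (P₀ : Fin (2 + 1) → ℚ) (hquad : ∀ z : Fin (2 + 1 + 1) → ℝ, (∀ j, 0 < SeparatePos.affF 2 1 (M j) z) → 0 < (σ₀ : ℝ) * (z 0 - X 0) ∧ 0 < (σ₁ : ℝ) * (z 1 - X 1)) (hact : ∀ j, RebasePos.jjE e j ≠ 0 → (RebasePos.jjL L ℓ₂ j).1 ≠ 0 → RebasePos.dd (RebasePos.jjL L ℓ₂ j) d ≠ 0) (hres0 : ∀ j j', RebasePos.jjE e j ≠ 0 → RebasePos.jjE e j' ≠ 0 → RebasePos.dd (RebasePos.jjL L ℓ₂ j) d ≠ 0 → RebasePos.dd (RebasePos.jjL L ℓ₂ j') d ≠ 0 → RebasePos.dd (RebasePos.jjL L ℓ₂ j') d • RebasePos.jjL L ℓ₂ j ≠ RebasePos.dd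 (RebasePos.jjL L ℓ₂ j) d • RebasePos.jjL L ℓ₂ j' → ¬ (∃ i i' : Fin m, j = Fin.castSucc i ∧ j' = Fin.castSucc i' ∧ RebasePos.valX (L i) X = 0 ∧ RebasePos.valX (L i') X = 0) → RebasePos.evQ (RebasePos.resF (RebasePos.jjL L ℓ₂ j) (RebasePos.jjL L ℓ₂ j') d) P₀ ≠ 0) (hnear : ∀ i : Fin m, e i ≠ 0 → (L i).1 ≠ 0 → RebasePos.valX (L i) X = 0 → (∀ z : Fin (2 + 1 + 1) → ℝ, (∀ j, 0 < SeparatePos.affF 2 1 (M j) z) → 0 < SeparatePos.affB 2 1 (L i) z) ∨ (∀ z : Fin (2 + 1 + 1) → ℝ, (∀ j, 0 < SeparatePos.affF 2 1 (M j) z) → SeparatePos.affB 2 1 (L i) z < 0)) (hfar0 : ∀ j, RebasePos.jjE e j ≠ 0 → RebasePos.dd (RebasePos.jjL L ℓ₂ j) d ≠ 0 → ¬ (∃ i : Fin m, j = Fin.castSucc i ∧ RebasePos.valX (L i) X = 0) → RebasePos.evQ (RebasePos.jjL L ℓ₂ j) P₀ ≠ 0) (hclose₁ : ∀ c : (Fin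 (2 + 1) → ℚ) × ℚ, ((∃ j, c = RebasePos.jjL L ℓ₂ j) ∨ (∃ j j', c = RebasePos.resF (RebasePos.jjL L ℓ₂ j) (RebasePos.jjL L ℓ₂ j') d)) → RebasePos.evQ c P₀ ≠ 0 → ∀ z : Fin (2 + 1 + 1) → ℝ, (∀ j, 0 < SeparatePos.affF 2 1 (M j) z) → 2 * |SeparatePos.affF 2 1 c z - (RebasePos.evQ c P₀ : ℝ)| < |(RebasePos.evQ c P₀ : ℝ)|) (hclose₂ : ∀ j, ∀ z : Fin (2 + 1 + 1) → ℝ, (∀ j, 0 < SeparatePos.affF 2 1 (M j) z) → |SeparatePos.affF 2 1 (RebasePos.jjL L ℓ₂ j) z - (RebasePos.evQ (RebasePos.jjL L ℓ₂ j) P₀ : ℝ)| ≤ 1) : ∃ c ∈ AddSubgroup.closure (SeparatePos.GGset 2 2 1), KZ.of s - c ∈ KZ.relations :=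
  RebasePos.good_chamber L e ℓ₁ ℓ₂ s M p u v hbd hdom hint huv σ₀ σ₁ q hσ₀ hσ₁ hq d hd0 hd1 hd θ hθ0 hθ1 hdu hlev X P₀ hquad hact hres0 hnear hfar0 hclose₁ hclose₂

end Summit.KontsevichZagierPeriods.ArrangementNormalForm.JanusBands
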